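import Summits.ValiantsHypothesis.ValiantsHypothesis.Theorems.LacunarySymmetroidMatrixDescartesCensusV19SShells2122Keys

/-!
# `MatrixDescartes` census — 2-SIDON `V = 19` layer, shells `21…22`: the kernel COVER check of the top `d₅ = 21`

HONEST FRAMING.  Object-search cell `pub-symmetroid`; door-A item `DoorA26 = PosRootLawAt 2 6 19` (stmt-ValiantsHypothesis-19979; OPEN, typed, never asserted).
Kernel bookkeeping only: `V20.coverSlicesX s2122Open s2122Keys` on the slices of the top `d₅ = 21` (every sorted support there is an exception, not 2-Sidon, a key,
or the mirror of a key).  Nothing here bears on `ζ_sym(2,6)`, on `DoorA26`, on `MatrixDescartes` (stmt-ValiantsHypothesis-18050) or on `VP ≠ VNP`.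

[folklore] Bookkeeping; elementary.
-/

-- the D-0017 layout repeats a namespace component (single-conjunct summit); the `dupNamespace` linter flags it; name mandated.
set_option linter.dupNamespace false

namespace Summit.ValiantsHypothesis.ValiantsHypothesis.Theorems.LacunarySymmetroidMatrixDescartes.Census.V19S

open V20 (coverSlicesX)

set_option maxHeartbeats 4000000 in
set_option maxRecDepth 200000 in
/-- Cover check of the slice `(21, 4, 13)`. [folklore] -/
theorem cover2122_21_s1 : coverSlicesX s2122Open s2122Keys [(21, 4, 13)] = true := by
  decide +kernel

set_option maxHeartbeats 4000000 in
set_option maxRecDepth 200000 in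
/-- Cover check of the slice `(21, 14, 16)`. [folklore] -/
theorem cover2122_21_s2 : coverSlicesX s2122Open s2122Keys [(21, 14, 16)] = true := by
  decide +kernel

set_option maxHeartbeats 4000000 in
set_option maxRecDepth 200000 in
/-- Cover check of the slice `(21, 17, 18)`. [folklore] -/
theorem cover2122_21_s3 : coverSlicesX s2122Open s2122Keys [(21, 17, 18)] = true := by
  decide +kernel

set_option maxHeartbeats 4000000 in
set_option maxRecDepth 200000 in
/-- Cover check of the slice `(21, 19, 19)`. [folklore] -/
theorem cover2122_21_s4 : coverSlicesX s2122Open s2122Keys [(21, 19, 19)] = true := by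
  decide +kernel

set_option maxHeartbeats 4000000 in
set_option maxRecDepth 200000 in
/-- Cover check of the slice `(21, 20, 20)`. [folklore] -/
theorem cover2122_21_s5 : coverSlicesX s2122Open s2122Keys [(21, 20, 20)] = true := by
  decide +kernel

/-- The cover slices of the top `d₅ = 21` together. [folklore] -/
theorem cover2122_21 : coverSlicesX s2122Open s2122Keys [(21, 4, 13), (21, 14, 16), (21, 17, 18), (21, 19, 19), (21, 20, 20)] = true := by
  have h1 := cover2122_21_s1; have h2 := cover2122_21_s2; have h3 := cover2122_21_s3; have h4 := cover2122_21_s4; have h5 := cover2122_21_s5;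
  unfold coverSlicesX at h1 h2 h3 h4 h5 ⊢
  simp only [List.all_cons, List.all_nil, Bool.and_true, Bool.and_eq_true] at h1 h2 h3 h4 h5 ⊢
  exact ⟨h1, h2, h3, h4, h5⟩

end Summit.ValiantsHypothesis.ValiantsHypothesis.Theorems.LacunarySymmetroidMatrixDescartes.Census.V19S
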